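import Mathlib
import Summits.SmoothPoincare4.SmoothPoincare4.Theses.SullivanDual
import Literature.Geometry.Symplectic.StandardEnd
import Literature.Geometry.Symplectic.JHolomorphicMap
import Summits.SmoothPoincare4.SmoothPoincare4.Theorems.SullivanDualTameOrBrodyR4StubChartTames
import Summits.SmoothPoincare4.SmoothPoincare4.Theorems.SullivanDualTameOrBrodyR4StubGluing
import Summits.SmoothPoincare4.SmoothPoincare4.Theorems.SullivanDualTameOrBrodyR4StubChartOfAnchors
import Summits.SmoothPoincare4.SmoothPoincare4.Theorems.SullivanDualTameOrBrodyR4StubAnchorOfPencil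
import Summits.SmoothPoincare4.SmoothPoincare4.Theorems.SullivanDualTameOrBrodyR4StubGraphOfPencil
import Summits.SmoothPoincare4.SmoothPoincare4.Theorems.SullivanDualTameOrBrodyR4StubGraphBounds
import Summits.SmoothPoincare4.SmoothPoincare4.Theorems.SullivanDualTameOrBrodyR4StubExteriorSchwarz
import Summits.SmoothPoincare4.SmoothPoincare4.Theorems.SullivanDualTameOrBrodyR4StubTailDeriv
import Summits.SmoothPoincare4.SmoothPoincare4.Theorems.SullivanDualTameOrBrodyR4StubTailParamDeriv
import Summits.SmoothPoincare4.SmoothPoincare4.Theorems.SullivanDualTameOrBrodyR4StubAnchorTail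
import Summits.SmoothPoincare4.SmoothPoincare4.Theorems.SullivanDualTameOrBrodyR4BlowUp

/-!
# Reduction of the crux `TameOrBrodyR4` to Gromov's two anchored pencils (line `Sketch`, item stmt-SmoothPoincare4-7826, route SullivanDual; lead prover file)

The crux — every `C^∞` almost complex structure `J` on `ℝ⁴ = EuclideanSpace ℝ (Fin 4)` standard on
`‖x‖ ≥ R` is EITHER tamed by a `C^∞` closed 2-form equal to `ω₀` outside a ball OR carries a bounded
non-constant entire `J`-curve (`Summit.SmoothPoincare4.SmoothPoincare4.Theses.SullivanDual.TameOrBrodyR4`)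
— follows from the NINETEEN stubs of the line skeleton `Cruxes/TameOrBrodyR4/Lines/Sketch.lean` (v7).
Eighteen of them are THEOREMS of the tree (files `Theorems/SullivanDualTameOrBrodyR4Stub*.lean`,
`…Apriori*.lean`, `…BlowUp.lean`); the nineteenth, the research core `stub_pencilsOrBlowup` — Gromov's
two complete pencils of `J`-planes anchored at the standard end, as evaluation maps, OR gradient
blow-up (Gromov 1985 §2.4.A / McDuff 1990 / Wendl 2018 Thm 6.8 run WITHOUT a taming form: automatic
transversality with a point constraint, positivity of intersections and adjunction, and the gradient
dichotomy in place of Gromov compactness) — is the entire `J`-holomorphic-curve content of the line and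
is not proved here.

This file records the reduction KERNEL-CHECKED and sorry-free, with NO definition: the hypothesis
`hP` of `TameOrBrodyR4_of_pencilsOrBlowup` is VERBATIM the registered stub signature of the research
core, universally quantified over `J, R` (skeleton §C1), and the proof is the skeleton's composition
with the eighteen landed stubs: pencils ⇒ (for each pencil, relative to the coordinate pair
`(P, Q) = (z, w)` resp. `(w, z)`) anchor map (`stub_anchorOfPencil`), far graph functions
(`stub_graphOfPencil`, `stub_graphBounds`), tail estimates (`stub_exteriorSchwarz`, `stub_tailDeriv`,
`stub_tailParamDeriv`), asymptotics of the anchor map (`stub_anchorTail`) ⇒ the twelve anchor clauses ⇒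
pencil chart (`stub_chartOfAnchors`) ⇒ it tames (`stub_chartTames`) ⇒ glued to `ω₀` at infinity
(`stub_gluing`) = disjunct 1; blow-up data ⇒ bounded entire `J`-curve (`helper_curveOfBlowup`, file
`…BlowUp.lean`) = disjunct 2. `helper_reductionToPencils` is the arrow form registered as a helper
sub-goal of the item. So the day the research core is proved the crux closes by one application.
The research core is NOT a restatement of the crux: its first disjunct is a pair of smooth bijective
evaluation maps with holomorphic slices and prescribed far behaviour, not a 2-form.

References: M. Gromov, *Pseudo holomorphic curves in symplectic manifolds*, Invent. Math. 82 (1985),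
§0.2.A, §2.4.A; D. McDuff, *The structure of rational and ruled symplectic 4-manifolds*, JAMS 3 (1990);
C. Wendl, *Holomorphic Curves in Low Dimensions*, LNM 2216 (2018), Thm 6.8; D. McDuff, D. Salamon,
*J-holomorphic curves and symplectic topology*, 2nd ed. (2012), §9.4.
-/

-- the registered namespace `Summit.SmoothPoincare4.SmoothPoincare4.…` repeats a component
set_option linter.dupNamespace false

noncomputable section

open scoped ContDiff Topology InnerProductSpace
open Filter Set Literature.Geometry.Symplectic

namespace Summit.SmoothPoincare4.SmoothPoincare4.Cruxes.TameOrBrodyR4.Sketch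

/-- Local notation for the model space `ℝ⁴ = EuclideanSpace ℝ (Fin 4)`. -/
local notation "E4" => EuclideanSpace ℝ (Fin 4)

namespace Reduction

/-- The coordinate maps `z, w : ℝ⁴ → ℂ` as continuous linear maps, with the Pythagorean identity and
operator norm bounds. -/
theorem exists_coordinate_clms :
    ∃ Z W : E4 →L[ℝ] ℂ, (∀ x, Z x = Complex.mk (x 0) (x 1)) ∧ (∀ x, W x = Complex.mk (x 2) (x 3)) ∧
      (∀ x : E4, ‖x‖ ^ 2 = ‖Z x‖ ^ 2 + ‖W x‖ ^ 2) := by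
  obtain ⟨Z, hZ⟩ := ChartOfAnchors.exists_clm_mk 0 1
  obtain ⟨W, hW⟩ := ChartOfAnchors.exists_clm_mk 2 3
  refine ⟨Z, W, hZ, hW, fun x => ?_⟩
  rw [EuclideanSpace.real_norm_sq_eq, Fin.sum_univ_four, hZ, hW, Complex.sq_norm, Complex.sq_norm,
    Complex.normSq_apply, Complex.normSq_apply]
  ring

/-- Where `J` is standard (`⟪J a, b⟫ = ω₀(a, b)`), the coordinate maps are `J`-complex-linear:
`z (J v) = i z v`, `w (J v) = i w v`. -/
theorem coordinate_J_mul {Jx : E4 →L[ℝ] E4} (h : ∀ a b : E4, ⟪Jx a, b⟫_ℝ = stdSymplecticForm a b)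
    (v : E4) :
    Complex.mk (Jx v 0) (Jx v 1) = Complex.I * Complex.mk (v 0) (v 1) ∧
      Complex.mk (Jx v 2) (Jx v 3) = Complex.I * Complex.mk (v 2) (v 3) := by
  obtain ⟨h0, h1, h2, h3⟩ := ChartOfAnchors.apply_of_inner_eq h v
  constructor <;> rw [Complex.I_mul] <;> apply Complex.ext <;> simp [h0, h1, h2, h3]

/-- **One pencil ⇒ one anchor map (C3, from the seven C2 stubs).** For a coordinate pair `(P, Q)`
with `‖x‖² = |P x|² + |Q x|²`, `J`-complex-linear where `‖x‖ ≥ R`, and a complete pencil `F` with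
(F1)–(F6), (F9) relative to `(P, Q)`: there is a `C^∞` submersion `b : ℝ⁴ → ℂ` with `J`-invariant
kernels, honest (`b = Q` where `|Q| ≥ R`), with `d(b - Q) → 0` at infinity and `|b - Q| ≤ 2R`, whose
kernel at `F b₀ ξ₀` is the tangent plane `range d(F b₀)_{ξ₀}`; the last clause is returned through a
right inverse `β` of the evaluation map. -/
theorem anchor_of_pencil (J : E4 → E4 →L[ℝ] E4) (R : ℝ) (hR : 0 < R) (P Q : E4 →L[ℝ] ℂ)
    (hPQ : ∀ x : E4, ‖x‖ ^ 2 = ‖P x‖ ^ 2 + ‖Q x‖ ^ 2)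
    (hJP : ∀ x : E4, R ≤ ‖x‖ → ∀ v, P (J x v) = Complex.I * P v)
    (hJQ : ∀ x : E4, R ≤ ‖x‖ → ∀ v, Q (J x v) = Complex.I * Q v)
    (F : ℂ → ℂ → E4) (hF1 : ContDiff ℝ ∞ (fun p : ℂ × ℂ => F p.1 p.2))
    (hF2 : Function.Bijective (fun p : ℂ × ℂ => F p.1 p.2))
    (hF3 : ∀ p : ℂ × ℂ, Function.Bijective (fderiv ℝ (fun p : ℂ × ℂ => F p.1 p.2) p))
    (hF4 : ∀ b, IsJHolomorphicFlat J (F b))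
    (hF5 : ∀ b : ℂ, R ≤ ‖b‖ → ∀ ξ, Q (F b ξ) = b)
    (hF5' : ∀ x : E4, R ≤ ‖Q x‖ → ∃ ξ, F (Q x) ξ = x)
    (hF6 : ∀ b c : ℂ, R ≤ ‖c‖ → ∃! ξ, P (F b ξ) = c)
    (hF6' : ∀ b ξ : ℂ, R ≤ ‖P (F b ξ)‖ → Function.Bijective (fderiv ℝ (fun ξ => P (F b ξ)) ξ))
    (hF9 : ∀ b, Tendsto (fun ξ => Q (F b ξ)) (cocompact ℂ) (𝓝 b)) :
    ∃ (bm : E4 → ℂ) (β : E4 → ℂ × ℂ), (∀ x, bm x = (β x).1) ∧ (∀ x, F (β x).1 (β x).2 = x) ∧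
      ContDiff ℝ ∞ bm ∧ (∀ x, Function.Surjective (fderiv ℝ bm x)) ∧
      (∀ x v, fderiv ℝ bm x v = 0 ↔ ∃ ζ : ℂ, v = fderiv ℝ (F (β x).1) (β x).2 ζ) ∧
      (∀ x v, fderiv ℝ bm x v = 0 → fderiv ℝ bm x (J x v) = 0) ∧
      (∀ x, R ≤ ‖Q x‖ → bm x = Q x) ∧
      Tendsto (fun x => ‖fderiv ℝ (fun y => bm y - Q y) x‖) (cocompact E4) (𝓝 0) ∧
      (∀ x, ‖bm x - Q x‖ ≤ 2 * R) := by
  -- C2a: inverse and anchor algebra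
  obtain ⟨β, hβ, hβl, hβr, hsurj, hker, hJinv, hhon, hslab⟩ :=
    stub_anchorOfPencil J R Q F hF1 hF2 hF3 hF4 hF5 hF5'
  -- C2b: graph functions
  obtain ⟨g, hg, hgh, hgF⟩ := stub_graphOfPencil J R P Q hPQ hJP hJQ F hF1 hF4 hF6 hF6'
  -- C2c: bounds and limit
  obtain ⟨gslab, ghon, glim⟩ := stub_graphBounds R P Q F g hF1.continuous hF2.1 hF5 hF5'
    (fun b c hc => (hF6 b c hc).exists) hF9 hgF
  have hgb : ∀ b c : ℂ, R < ‖c‖ → ‖g b c - b‖ ≤ 2 * R := by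
    intro b c hc
    rcases lt_or_ge ‖b‖ R with hb | hb
    · calc ‖g b c - b‖ ≤ ‖g b c‖ + ‖b‖ := norm_sub_le _ _
        _ ≤ R + R := add_le_add (gslab b c hb hc.le).le hb.le
        _ = 2 * R := by ring
    · rw [ghon b c hb hc.le, sub_self, norm_zero]; positivity
  -- C2d–f: tail estimates
  have hT1 := stub_tailDeriv stub_exteriorSchwarz R (2 * R) hR g hgh hgb glim
  have hT2 := stub_tailParamDeriv stub_exteriorSchwarz R (2 * R) hR g hg hgh hgb glim
  -- C2g: d(b - Q) → 0
  have htail := stub_anchorTail R hR P Q hPQ F β g hβ hβr hhon hslab hg hgF hT1 hT2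
  refine ⟨fun x => (β x).1, β, fun x => rfl, hβr, ?_, hsurj, hker, hJinv, hhon, htail, ?_⟩
  · exact contDiff_fst.comp hβ
  · intro x
    show ‖(β x).1 - Q x‖ ≤ 2 * R
    rcases lt_or_ge ‖Q x‖ R with hx | hx
    · calc ‖(β x).1 - Q x‖ ≤ ‖(β x).1‖ + ‖Q x‖ := norm_sub_le _ _
        _ ≤ R + R := add_le_add (hslab x hx).le hx.le
        _ = 2 * R := by ring
    · rw [hhon x hx, sub_self, norm_zero]; positivity

/-- **Anchors or blow-up from pencils or blow-up.** Either the anchor maps `b, c : ℝ⁴ → ℂ` of the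
two complete pencils exist with the twelve clauses of `stub_chartOfAnchors`, or blow-up data — from
the research core's dichotomy for this `J`: run `anchor_of_pencil` for `F` with `(P, Q) = (z, w)` and
for `G` with `(P, Q) = (w, z)`; transversality of the two kernels is clause (T). -/
theorem anchorsOrBlowup_of (J : E4 → E4 →L[ℝ] E4) (R : ℝ) (hR : 0 < R)
    (hJi : ∀ x : E4, R ≤ ‖x‖ → ∀ a b : E4, ⟪J x a, b⟫_ℝ = stdSymplecticForm a b)
    (hP :
      (∃ F G : ℂ → ℂ → E4,
        ContDiff ℝ ∞ (fun p : ℂ × ℂ => F p.1 p.2) ∧ ContDiff ℝ ∞ (fun p : ℂ × ℂ => G p.1 p.2) ∧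
        Function.Bijective (fun p : ℂ × ℂ => F p.1 p.2) ∧
        Function.Bijective (fun p : ℂ × ℂ => G p.1 p.2) ∧
        (∀ p : ℂ × ℂ, Function.Bijective (fderiv ℝ (fun p : ℂ × ℂ => F p.1 p.2) p)) ∧
        (∀ p : ℂ × ℂ, Function.Bijective (fderiv ℝ (fun p : ℂ × ℂ => G p.1 p.2) p)) ∧
        (∀ b, IsJHolomorphicFlat J (F b)) ∧ (∀ c, IsJHolomorphicFlat J (G c)) ∧
        (∀ b : ℂ, R ≤ ‖b‖ → ∀ ξ, Complex.mk (F b ξ 2) (F b ξ 3) = b) ∧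
        (∀ x : E4, R ≤ ‖Complex.mk (x 2) (x 3)‖ → ∃ ξ, F (Complex.mk (x 2) (x 3)) ξ = x) ∧
        (∀ c : ℂ, R ≤ ‖c‖ → ∀ η, Complex.mk (G c η 0) (G c η 1) = c) ∧
        (∀ x : E4, R ≤ ‖Complex.mk (x 0) (x 1)‖ → ∃ η, G (Complex.mk (x 0) (x 1)) η = x) ∧
        (∀ b c : ℂ, R ≤ ‖c‖ → ∃! ξ, Complex.mk (F b ξ 0) (F b ξ 1) = c) ∧
        (∀ b ξ : ℂ, R ≤ ‖Complex.mk (F b ξ 0) (F b ξ 1)‖ →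
          Function.Bijective (fderiv ℝ (fun ξ => Complex.mk (F b ξ 0) (F b ξ 1)) ξ)) ∧
        (∀ c b : ℂ, R ≤ ‖b‖ → ∃! η, Complex.mk (G c η 2) (G c η 3) = b) ∧
        (∀ c η : ℂ, R ≤ ‖Complex.mk (G c η 2) (G c η 3)‖ →
          Function.Bijective (fderiv ℝ (fun η => Complex.mk (G c η 2) (G c η 3)) η)) ∧
        (∀ b, Tendsto (fun ξ => Complex.mk (F b ξ 2) (F b ξ 3)) (cocompact ℂ) (𝓝 b)) ∧
        (∀ c, Tendsto (fun η => Complex.mk (G c η 0) (G c η 1)) (cocompact ℂ) (𝓝 c)) ∧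
        (∀ b ξ c η, F b ξ = G c η → ∀ v v' : ℂ,
          fderiv ℝ (F b) ξ v = fderiv ℝ (G c) η v' → v = 0)) ∨
      (∃ (K : Set E4) (f : ℕ → ℂ → E4), IsCompact K ∧ (∀ n, ContDiff ℝ ∞ (f n)) ∧
        (∀ n, IsJHolomorphicFlat J (f n)) ∧ (∀ n (z : ℂ), ‖z‖ ≤ 1 → f n z ∈ K) ∧
        Tendsto (fun n => ‖fderiv ℝ (f n) 0‖) atTop atTop)) :
    (∃ b c : E4 → ℂ, ContDiff ℝ ∞ b ∧ ContDiff ℝ ∞ c ∧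
      (∀ x, Function.Surjective (fderiv ℝ b x)) ∧
      (∀ x, Function.Surjective (fderiv ℝ c x)) ∧
      (∀ x v, fderiv ℝ b x v = 0 → fderiv ℝ b x (J x v) = 0) ∧
      (∀ x v, fderiv ℝ c x v = 0 → fderiv ℝ c x (J x v) = 0) ∧
      (∀ x v, fderiv ℝ b x v = 0 → fderiv ℝ c x v = 0 → v = 0) ∧
      (∀ x : E4, R ≤ ‖(Complex.mk (x 0) (x 1))‖ → c x = Complex.mk (x 0) (x 1)) ∧
      (∀ x : E4, R ≤ ‖(Complex.mk (x 2) (x 3))‖ → b x = Complex.mk (x 2) (x 3)) ∧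
      Tendsto (fun x => ‖fderiv ℝ (fun y : E4 => b y - Complex.mk (y 2) (y 3)) x‖)
        (cocompact E4) (𝓝 0) ∧
      Tendsto (fun x => ‖fderiv ℝ (fun y : E4 => c y - Complex.mk (y 0) (y 1)) x‖)
        (cocompact E4) (𝓝 0) ∧
      (∃ C : ℝ, ∀ x : E4,
        ‖b x - Complex.mk (x 2) (x 3)‖ ≤ C ∧ ‖c x - Complex.mk (x 0) (x 1)‖ ≤ C)) ∨
    (∃ (K : Set E4) (f : ℕ → ℂ → E4), IsCompact K ∧ (∀ n, ContDiff ℝ ∞ (f n)) ∧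
      (∀ n, IsJHolomorphicFlat J (f n)) ∧ (∀ n (z : ℂ), ‖z‖ ≤ 1 → f n z ∈ K) ∧
      Tendsto (fun n => ‖fderiv ℝ (f n) 0‖) atTop atTop) := by
  rcases hP with
    ⟨F, G, hF1, hG1, hF2, hG2, hF3, hG3, hF4, hG4, hF5, hF5', hG5, hG5', hF6, hF6', hG6, hG6',
      hF9, hG9, hT⟩ | hblow
  · left
    obtain ⟨Z, W, hZ, hW, hZW⟩ := exists_coordinate_clms
    have hWZ : ∀ x : E4, ‖x‖ ^ 2 = ‖W x‖ ^ 2 + ‖Z x‖ ^ 2 := fun x => by rw [hZW x, add_comm]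
    have hJZ : ∀ x : E4, R ≤ ‖x‖ → ∀ v, Z (J x v) = Complex.I * Z v := fun x hx v => by
      rw [hZ, hZ]; exact (coordinate_J_mul (hJi x hx) v).1
    have hJW : ∀ x : E4, R ≤ ‖x‖ → ∀ v, W (J x v) = Complex.I * W v := fun x hx v => by
      rw [hW, hW]; exact (coordinate_J_mul (hJi x hx) v).2
    -- the `A`-pencil `F` relative to `(P, Q) = (Z, W)`
    obtain ⟨bm, β, hbm, hβr, hbs, hbsurj, hbker, hbJ, hbhon, hbtail, hbC⟩ :=
      anchor_of_pencil J R hR Z W hZW hJZ hJW F hF1 hF2 hF3 hF4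
        (fun b hb ξ => by rw [hW]; exact hF5 b hb ξ)
        (fun x hx => by rw [hW] at hx ⊢; exact hF5' x hx)
        (fun b c hc => by simp only [hZ]; exact hF6 b c hc)
        (fun b ξ h => by simp only [hZ] at h ⊢; exact hF6' b ξ h)
        (fun b => by simp only [hW]; exact hF9 b)
    -- the `B`-pencil `G` relative to `(P, Q) = (W, Z)`
    obtain ⟨cm, γ, hcm, hγr, hcs, hcsurj, hcker, hcJ, hchon, hctail, hcC⟩ :=
      anchor_of_pencil J R hR W Z hWZ hJW hJZ G hG1 hG2 hG3 hG4
        (fun c hc η => by rw [hZ]; exact hG5 c hc η)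
        (fun x hx => by rw [hZ] at hx ⊢; exact hG5' x hx)
        (fun c b hb => by simp only [hW]; exact hG6 c b hb)
        (fun c η h => by simp only [hW] at h ⊢; exact hG6' c η h)
        (fun c => by simp only [hZ]; exact hG9 c)
    refine ⟨bm, cm, hbs, hcs, hbsurj, hcsurj, hbJ, hcJ, ?_, ?_, ?_, ?_, ?_, ⟨2 * R, fun x => ⟨?_, ?_⟩⟩⟩
    · -- transversality of the two kernels, from (T)
      intro x v hbv hcv
      obtain ⟨ζ, hζ⟩ := (hbker x v).1 hbv
      obtain ⟨ζ', hζ'⟩ := (hcker x v).1 hcv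
      have hx : F (β x).1 (β x).2 = G (γ x).1 (γ x).2 := by rw [hβr, hγr]
      have h0 : ζ = 0 := hT _ _ _ _ hx ζ ζ' (by rw [← hζ, ← hζ'])
      rw [hζ, h0, map_zero]
    · intro x hx; rw [← hZ] at hx ⊢; exact hchon x hx
    · intro x hx; rw [← hW] at hx ⊢; exact hbhon x hx
    · simpa only [hW] using hbtail
    · simpa only [hZ] using hctail
    · rw [← hW]; exact hbC x
    · rw [← hZ]; exact hcC x
  · exact Or.inr hblow

end Reduction

/-- **The crux reduces to the research core.** If, for every `C^∞` almost complex structure `J` on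
`ℝ⁴` standard on `‖x‖ ≥ R`, Gromov's two anchored pencils exist as evaluation maps (or a pencil
breaks by gradient blow-up) — hypothesis `hP`, VERBATIM the registered stub `stub_pencilsOrBlowup`
of the line skeleton quantified over `J, R` — then `TameOrBrodyR4` holds: pencils ⇒ anchors
(`Reduction.anchorsOrBlowup_of`) ⇒ pencil chart (`stub_chartOfAnchors`) ⇒ tames (`stub_chartTames`)
⇒ glued to `ω₀` (`stub_gluing`); blow-up ⇒ bounded entire `J`-curve (`helper_curveOfBlowup`).
[cite: Gromov1985, §2.4.A] -/
theorem TameOrBrodyR4_of_pencilsOrBlowup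
    (hP :
      ∀ (J : E4 → E4 →L[ℝ] E4) (R : ℝ), 0 < R → ContDiff ℝ ∞ J → (∀ x v, J x (J x v) = -v) →
        (∀ x : E4, R ≤ ‖x‖ → ∀ a b : E4, ⟪J x a, b⟫_ℝ = stdSymplecticForm a b) →
        (∃ F G : ℂ → ℂ → E4,
          ContDiff ℝ ∞ (fun p : ℂ × ℂ => F p.1 p.2) ∧ ContDiff ℝ ∞ (fun p : ℂ × ℂ => G p.1 p.2) ∧
          Function.Bijective (fun p : ℂ × ℂ => F p.1 p.2) ∧
          Function.Bijective (fun p : ℂ × ℂ => G p.1 p.2) ∧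
          (∀ p : ℂ × ℂ, Function.Bijective (fderiv ℝ (fun p : ℂ × ℂ => F p.1 p.2) p)) ∧
          (∀ p : ℂ × ℂ, Function.Bijective (fderiv ℝ (fun p : ℂ × ℂ => G p.1 p.2) p)) ∧
          (∀ b, IsJHolomorphicFlat J (F b)) ∧ (∀ c, IsJHolomorphicFlat J (G c)) ∧
          (∀ b : ℂ, R ≤ ‖b‖ → ∀ ξ, Complex.mk (F b ξ 2) (F b ξ 3) = b) ∧
          (∀ x : E4, R ≤ ‖Complex.mk (x 2) (x 3)‖ → ∃ ξ, F (Complex.mk (x 2) (x 3)) ξ = x) ∧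
          (∀ c : ℂ, R ≤ ‖c‖ → ∀ η, Complex.mk (G c η 0) (G c η 1) = c) ∧
          (∀ x : E4, R ≤ ‖Complex.mk (x 0) (x 1)‖ → ∃ η, G (Complex.mk (x 0) (x 1)) η = x) ∧
          (∀ b c : ℂ, R ≤ ‖c‖ → ∃! ξ, Complex.mk (F b ξ 0) (F b ξ 1) = c) ∧
          (∀ b ξ : ℂ, R ≤ ‖Complex.mk (F b ξ 0) (F b ξ 1)‖ →
            Function.Bijective (fderiv ℝ (fun ξ => Complex.mk (F b ξ 0) (F b ξ 1)) ξ)) ∧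
          (∀ c b : ℂ, R ≤ ‖b‖ → ∃! η, Complex.mk (G c η 2) (G c η 3) = b) ∧
          (∀ c η : ℂ, R ≤ ‖Complex.mk (G c η 2) (G c η 3)‖ →
            Function.Bijective (fderiv ℝ (fun η => Complex.mk (G c η 2) (G c η 3)) η)) ∧
          (∀ b, Tendsto (fun ξ => Complex.mk (F b ξ 2) (F b ξ 3)) (cocompact ℂ) (𝓝 b)) ∧
          (∀ c, Tendsto (fun η => Complex.mk (G c η 0) (G c η 1)) (cocompact ℂ) (𝓝 c)) ∧
          (∀ b ξ c η, F b ξ = G c η → ∀ v v' : ℂ,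
            fderiv ℝ (F b) ξ v = fderiv ℝ (G c) η v' → v = 0)) ∨
        (∃ (K : Set E4) (f : ℕ → ℂ → E4), IsCompact K ∧ (∀ n, ContDiff ℝ ∞ (f n)) ∧
          (∀ n, IsJHolomorphicFlat J (f n)) ∧ (∀ n (z : ℂ), ‖z‖ ≤ 1 → f n z ∈ K) ∧
          Tendsto (fun n => ‖fderiv ℝ (f n) 0‖) atTop atTop)) :
    Summit.SmoothPoincare4.SmoothPoincare4.Theses.SullivanDual.TameOrBrodyR4 := by
  intro J R hR hJs hJ2 hJi
  rcases Reduction.anchorsOrBlowup_of J R hR hJi (hP J R hR hJs hJ2 hJi) with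
    ⟨b, c, hb, hc, hbs, hcs, hbJ, hcJ, htr, hch, hbh, hbD, hcD, hC⟩ |
    ⟨K, f, hK, hf, hfJ, hfK, hblow⟩
  · left
    obtain ⟨Φ, hΦ, hbij, hA, hB, hposA, hposB, hD, hC'⟩ :=
      stub_chartOfAnchors J R hJs hJ2 hJi b c hb hc hbs hcs hbJ hcJ htr hch hbh hbD hcD hC
    exact stub_gluing J R hR hJi Φ hΦ hD hC' (stub_chartTames J Φ hbij hA hB hposA hposB)
  · right
    obtain ⟨u, hu⟩ := helper_curveOfBlowup J hJs hJ2 K f hK hf hfJ hfK hblow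
    exact ⟨u, hu.1, hu.2.1, hu.2.2.1, hu.2.2.2⟩

/-- **Registered helper `helper_reductionToPencils`** (the arrow form of
`TameOrBrodyR4_of_pencilsOrBlowup`): research core ⇒ crux. -/
theorem helper_reductionToPencils :
    (∀ (J : E4 → E4 →L[ℝ] E4) (R : ℝ), 0 < R → ContDiff ℝ ∞ J → (∀ x v, J x (J x v) = -v) →
        (∀ x : E4, R ≤ ‖x‖ → ∀ a b : E4, ⟪J x a, b⟫_ℝ = stdSymplecticForm a b) →
        (∃ F G : ℂ → ℂ → E4,
          ContDiff ℝ ∞ (fun p : ℂ × ℂ => F p.1 p.2) ∧ ContDiff ℝ ∞ (fun p : ℂ × ℂ => G p.1 p.2) ∧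
          Function.Bijective (fun p : ℂ × ℂ => F p.1 p.2) ∧
          Function.Bijective (fun p : ℂ × ℂ => G p.1 p.2) ∧
          (∀ p : ℂ × ℂ, Function.Bijective (fderiv ℝ (fun p : ℂ × ℂ => F p.1 p.2) p)) ∧
          (∀ p : ℂ × ℂ, Function.Bijective (fderiv ℝ (fun p : ℂ × ℂ => G p.1 p.2) p)) ∧
          (∀ b, IsJHolomorphicFlat J (F b)) ∧ (∀ c, IsJHolomorphicFlat J (G c)) ∧
          (∀ b : ℂ, R ≤ ‖b‖ → ∀ ξ, Complex.mk (F b ξ 2) (F b ξ 3) = b) ∧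
          (∀ x : E4, R ≤ ‖Complex.mk (x 2) (x 3)‖ → ∃ ξ, F (Complex.mk (x 2) (x 3)) ξ = x) ∧
          (∀ c : ℂ, R ≤ ‖c‖ → ∀ η, Complex.mk (G c η 0) (G c η 1) = c) ∧
          (∀ x : E4, R ≤ ‖Complex.mk (x 0) (x 1)‖ → ∃ η, G (Complex.mk (x 0) (x 1)) η = x) ∧
          (∀ b c : ℂ, R ≤ ‖c‖ → ∃! ξ, Complex.mk (F b ξ 0) (F b ξ 1) = c) ∧
          (∀ b ξ : ℂ, R ≤ ‖Complex.mk (F b ξ 0) (F b ξ 1)‖ →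
            Function.Bijective (fderiv ℝ (fun ξ => Complex.mk (F b ξ 0) (F b ξ 1)) ξ)) ∧
          (∀ c b : ℂ, R ≤ ‖b‖ → ∃! η, Complex.mk (G c η 2) (G c η 3) = b) ∧
          (∀ c η : ℂ, R ≤ ‖Complex.mk (G c η 2) (G c η 3)‖ →
            Function.Bijective (fderiv ℝ (fun η => Complex.mk (G c η 2) (G c η 3)) η)) ∧
          (∀ b, Tendsto (fun ξ => Complex.mk (F b ξ 2) (F b ξ 3)) (cocompact ℂ) (𝓝 b)) ∧
          (∀ c, Tendsto (fun η => Complex.mk (G c η 0) (G c η 1)) (cocompact ℂ) (𝓝 c)) ∧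
          (∀ b ξ c η, F b ξ = G c η → ∀ v v' : ℂ,
            fderiv ℝ (F b) ξ v = fderiv ℝ (G c) η v' → v = 0)) ∨
        (∃ (K : Set E4) (f : ℕ → ℂ → E4), IsCompact K ∧ (∀ n, ContDiff ℝ ∞ (f n)) ∧
          (∀ n, IsJHolomorphicFlat J (f n)) ∧ (∀ n (z : ℂ), ‖z‖ ≤ 1 → f n z ∈ K) ∧
          Tendsto (fun n => ‖fderiv ℝ (f n) 0‖) atTop atTop)) →
    Summit.SmoothPoincare4.SmoothPoincare4.Theses.SullivanDual.TameOrBrodyR4 :=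
  fun hP => TameOrBrodyR4_of_pencilsOrBlowup hP

end Summit.SmoothPoincare4.SmoothPoincare4.Cruxes.TameOrBrodyR4.Sketch
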